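import Literature.MathematicalPhysics.QuantumFieldTheory.Balaban1983to89.B5Eq117TorusCarriers
import Literature.MathematicalPhysics.QuantumFieldTheory.Balaban1983to89.B5Eq118OneStroke
import HarnessLib

/-!
# Route `UnitScaleTilt`, crux K1 child «MinimiserStabilityRegPr» (stmt-QuantumFields-19200), skeleton v10, stub `stub_existenceMinimalOrbit` (EX), route (α) —
# **(ROW-R2q″, FILE 2b) THE FAT SEPARABLE BLOCK BUMP**: on every top block `B^k(Y)` (side `M = L^k`) the product of three (d) one-dimensional ramps
# `ρ(t) = min 1 (min (t∕(wM)) ((M−1−t)∕(wM)))` of the label offsets — `χ_Y(x) = Π_ν ρ(x_ν mod M)` on `B^k(Y)`, `0` elsewhere — with the rows the extension file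
# ✓`Prop7BlockBumpExtension.exists_blockBumpExtension` displays (range `[0,1]`, support inside the block WITH its neighbours, bond-Lipschitz constant `lχ = 1∕(wM)`) and the
# MASS IDENTITY `Σ_{x∈B^k(Y)} χ_Y(x) = κ·M^d` with ONE `κ` for all blocks, `(1 − 2w − 2∕M)^d ≤ κ ≤ 1` — ★w5-20520 g7's design word 2026-08-28 19:56Z∕19:57Z («fat separable bump,
# collar `w`», so that the Neumann budget `θκ` of the (P2-core) solve door is not squeezed by a thin profile).

Cell `ym3-torus`, width seat `ym3-torus-px10` (gen 2).  THEOREMS ONLY (0 `def`, 0 `sorry`).  `--supports stmt-QuantumFields-19200 --as helper`, count-neutral.  YM₃ on T³ is a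
ladder rung (R3), not the Clay problem; nothing here claims the stub, the crux, d = 4 or the mass gap.

WHAT IS PROVED (sorry-free, no definition; ns `…Theorems.Prop7BlockFatBump`; generic `P`, level `k ≤ m + K`, collar `0 < w`):
* §1 the 1-D ramp (written out, no `def`): `ramp_mem_Icc`, `ramp_zero`, `ramp_last`, ★`abs_ramp_succ_sub_le` (`|ρ(t+1) − ρ(t)| ≤ 1∕(wM)`), `ramp_eq_one_of` (plateau),
  ★`sum_ramp_bounds` (`M(1 − 2w) − 2 ≤ Σ_{t<M} ρ t ≤ M`).
* §2 labels (generic `P`): `val_eq_of_iterBlockOf` (`x_ν = (B^k x)_ν·L^k + x_ν mod L^k`), `val_add_le_sitesPerDir`, `one_lt_sitesPerDir_zero`, `iterBlockOf_eq_iff`,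
  ★`shift_of_offset_succ_lt` ∕ ★`unshift_of_offset_pos` (interior steps keep the block, labels move by one), ★`offsets_of_iterBlockOf_shift_ne` (leaving a block happens at offset
  `L^k − 1`, entering at `0`), ★`iterBlockOf_shift_ne_of_offset_last` (at the last offset the step leaves — two blocks per direction at least).
* §3 ★★★`exists_fatBump` — `∃ χ κ`: range, support-with-neighbours (both directions), bond-Lipschitz `1∕(w·L^k)`, the mass identity, `(1 − 2w − 2∕L^k)^d ≤ κ ≤ 1` (window `2w + 2∕L^k ≤ 1`).
HONEST SCOPE: elementary; constants as displayed; nothing of print asserted.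

References: T. Bałaban, CMP 95 (1984) 17–40 [Balaban1984PropagatorsI] ((1.6), (1.18)); CMP 99 (1985) 389–434 [Balaban1985BackgroundPropagators] ((3.114)–(3.115)); CMP 109 (1987) [Balaban1987RG1] ((0.1)).
-/

set_option autoImplicit false

noncomputable section

open scoped BigOperators

namespace Summit.QuantumFields.YangMills.Theorems.Prop7BlockFatBump

open Literature.MathematicalPhysics.QuantumFieldTheory.Balaban1983to89
open B5Eq118OneStroke (iterBlockOf iterBlock mem_iterBlock mem_iterBlock_iff val_iterBlockOf)
open B5Eq117TorusCarriers (blockSiteK val_blockSiteK sum_iterBlock_eq sitesPerDir_zero_eq)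

/-! ## §1 The one-dimensional ramp `ρ(t) = min 1 (min (t∕(wM)) ((M−1−t)∕(wM)))` -/

section Ramp

variable {M : ℕ} {w : ℝ}

/-- `0 ≤ ρ(t) ≤ 1` for `t ≤ M − 1`. [folklore] -/
theorem ramp_mem_Icc (hw : 0 < w) (hM : 0 < M) {t : ℕ} (ht : t < M) :
    0 ≤ min (1 : ℝ) (min ((t : ℝ) / (w * M)) (((M : ℝ) - 1 - t) / (w * M))) ∧ min (1 : ℝ) (min ((t : ℝ) / (w * M)) (((M : ℝ) - 1 - t) / (w * M))) ≤ 1 := by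
  have hwM : 0 < w * M := by positivity
  have ht' : (t : ℝ) ≤ (M : ℝ) - 1 := by
    have : t + 1 ≤ M := ht
    have : ((t + 1 : ℕ) : ℝ) ≤ (M : ℝ) := by exact_mod_cast this
    push_cast at this; linarith
  refine ⟨le_min zero_le_one (le_min (by positivity) (div_nonneg (by linarith) hwM.le)), min_le_left _ _⟩

/-- `ρ(0) = 0`. [folklore] -/
theorem ramp_zero (hw : 0 < w) (hM : 0 < M) : min (1 : ℝ) (min (((0 : ℕ) : ℝ) / (w * M)) (((M : ℝ) - 1 - ((0 : ℕ) : ℝ)) / (w * M))) = 0 := by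
  have hwM : 0 < w * M := by positivity
  have h1 : (1 : ℝ) ≤ M := by exact_mod_cast hM
  rw [Nat.cast_zero, zero_div, sub_zero, min_eq_right, min_eq_left]
  · exact div_nonneg (by linarith) hwM.le
  · exact le_trans (min_le_left _ _) zero_le_one

/-- `ρ(M − 1) = 0`. [folklore] -/
theorem ramp_last (hw : 0 < w) (hM : 0 < M) : min (1 : ℝ) (min ((((M - 1 : ℕ)) : ℝ) / (w * M)) (((M : ℝ) - 1 - ((M - 1 : ℕ) : ℝ)) / (w * M))) = 0 := by
  have hwM : 0 < w * M := by positivity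
  have h1 : ((M - 1 : ℕ) : ℝ) = (M : ℝ) - 1 := by rw [Nat.cast_sub (by omega), Nat.cast_one]
  have h2 : (1 : ℝ) ≤ M := by exact_mod_cast hM
  rw [h1, sub_self, zero_div, min_eq_right, min_eq_right]
  · exact div_nonneg (by linarith) hwM.le
  · exact le_trans (min_le_right _ _) zero_le_one

/-- **THE RAMP IS `1∕(wM)`-LIPSCHITZ ALONG THE LABELS**: `|ρ(t+1) − ρ(t)| ≤ 1∕(wM)`. [folklore] -/
theorem abs_ramp_succ_sub_le (hw : 0 < w) (hM : 0 < M) (t : ℕ) :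
    |min (1 : ℝ) (min ((((t + 1 : ℕ)) : ℝ) / (w * M)) (((M : ℝ) - 1 - ((t + 1 : ℕ) : ℝ)) / (w * M)))
        - min (1 : ℝ) (min ((t : ℝ) / (w * M)) (((M : ℝ) - 1 - t) / (w * M)))| ≤ 1 / (w * M) := by
  have hwM : 0 < w * M := by positivity
  refine (abs_min_sub_min_le_max _ _ _ _).trans (max_le (by rw [sub_self, abs_zero]; positivity) ((abs_min_sub_min_le_max _ _ _ _).trans (max_le ?_ ?_)))
  · rw [← sub_div, abs_div, abs_of_pos hwM]; push_cast; refine div_le_div_of_nonneg_right (le_of_eq ?_) hwM.le; norm_num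
  · rw [← sub_div, abs_div, abs_of_pos hwM]; push_cast; refine div_le_div_of_nonneg_right (le_of_eq ?_) hwM.le
    rw [show (M : ℝ) - 1 - (t + 1) - ((M : ℝ) - 1 - t) = -1 by ring, abs_neg, abs_one]

/-- the plateau: `ρ(t) = 1` whenever `wM ≤ t` and `t ≤ M − 1 − wM`. [folklore] -/
theorem ramp_eq_one_of (hw : 0 < w) (hM : 0 < M) {t : ℕ} (h1 : w * M ≤ t) (h2 : (t : ℝ) ≤ (M : ℝ) - 1 - w * M) :
    min (1 : ℝ) (min ((t : ℝ) / (w * M)) (((M : ℝ) - 1 - t) / (w * M))) = 1 := by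
  have hwM : 0 < w * M := by positivity
  refine min_eq_left (le_min ?_ ?_)
  · rwa [le_div_iff₀ hwM, one_mul]
  · rw [le_div_iff₀ hwM, one_mul]; linarith

/-- **THE MASS OF THE RAMP**: `M·(1 − 2w) − 2 ≤ Σ_{t<M} ρ(t)` (the plateau alone) and `Σ_{t<M} ρ(t) ≤ M`. [folklore] -/
theorem sum_ramp_bounds (hw : 0 < w) (hM : 0 < M) :
    (M : ℝ) * (1 - 2 * w) - 2 ≤ ∑ t ∈ Finset.range M, min (1 : ℝ) (min ((t : ℝ) / (w * M)) (((M : ℝ) - 1 - t) / (w * M))) ∧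
      ∑ t ∈ Finset.range M, min (1 : ℝ) (min ((t : ℝ) / (w * M)) (((M : ℝ) - 1 - t) / (w * M))) ≤ M := by
  have hwM : 0 < w * M := by positivity
  constructor
  · -- the plateau indices `⌈wM⌉ ≤ t ≤ M − 1 − ⌈wM⌉`
    set a : ℕ := ⌈w * M⌉₊ with ha
    have haw : w * M ≤ a := Nat.le_ceil _
    have ha1 : (a : ℝ) < w * M + 1 := Nat.ceil_lt_add_one hwM.le
    by_cases hsmall : 2 * a + 1 ≤ M
    · -- the plateau `[a, M − 1 − a]` has `M − 2a` points, each with `ρ = 1`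
      have hsub : Finset.Ico a (M - a) ⊆ Finset.range M := by
        intro t ht; rw [Finset.mem_Ico] at ht; rw [Finset.mem_range]; omega
      have hle : ∑ t ∈ Finset.Ico a (M - a), min (1 : ℝ) (min ((t : ℝ) / (w * M)) (((M : ℝ) - 1 - t) / (w * M)))
          ≤ ∑ t ∈ Finset.range M, min (1 : ℝ) (min ((t : ℝ) / (w * M)) (((M : ℝ) - 1 - t) / (w * M))) :=
        Finset.sum_le_sum_of_subset_of_nonneg hsub fun t ht _ => (ramp_mem_Icc hw hM (Finset.mem_range.mp ht)).1
      refine le_trans ?_ hle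
      have hplat : ∀ t ∈ Finset.Ico a (M - a), min (1 : ℝ) (min ((t : ℝ) / (w * M)) (((M : ℝ) - 1 - t) / (w * M))) = 1 := by
        intro t ht
        rw [Finset.mem_Ico] at ht
        have h3 : t + 1 + a ≤ M := by omega
        have h4 : ((t + 1 + a : ℕ) : ℝ) ≤ (M : ℝ) := by exact_mod_cast h3
        have h5 : (a : ℝ) ≤ t := by exact_mod_cast ht.1
        push_cast at h4
        exact ramp_eq_one_of hw hM (le_trans haw h5) (by linarith)
      rw [Finset.sum_congr rfl hplat, Finset.sum_const, Nat.card_Ico, nsmul_eq_mul, mul_one]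
      have h5 : ((M - a - a : ℕ) : ℝ) = (M : ℝ) - a - a := by
        rw [Nat.cast_sub (by omega), Nat.cast_sub (by omega)]
      rw [h5]; linarith
    · -- tiny blocks: the bound is nonpositive
      have h6 : (M : ℝ) ≤ 2 * a := by exact_mod_cast (show M ≤ 2 * a by omega)
      have h7 : (M : ℝ) * (1 - 2 * w) - 2 ≤ 0 := by nlinarith
      exact h7.trans (Finset.sum_nonneg fun t ht => (ramp_mem_Icc hw hM (Finset.mem_range.mp ht)).1)
  · calc ∑ t ∈ Finset.range M, min (1 : ℝ) (min ((t : ℝ) / (w * M)) (((M : ℝ) - 1 - t) / (w * M))) ≤ ∑ _t ∈ Finset.range M, (1 : ℝ) :=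
          Finset.sum_le_sum fun t ht => (ramp_mem_Icc hw hM (Finset.mem_range.mp ht)).2
      _ = M := by simp

end Ramp

/-! ## §2 Labels and offsets inside a top block: moving along a bond -/

section Labels

variable {P : Params} {k : ℕ}

/-- `x_ν = (B^k x)_ν·L^k + (x_ν mod L^k)` (labels; ✓`val_iterBlockOf`). [cite: Balaban1984PropagatorsI, (1.6) p.18] -/
theorem val_eq_of_iterBlockOf (hk : k ≤ P.m + P.K) (x : Site P 0) (ν : Fin P.d) :
    (x ν).val = ((iterBlockOf k x) ν).val * P.L ^ k + (x ν).val % P.L ^ k := by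
  rw [val_iterBlockOf k hk x ν, mul_comm]
  exact (Nat.div_add_mod _ _).symm

/-- no wrap-around inside a block: `x_ν + L^k ≤ N₀ + (x_ν mod L^k)`. [cite: Balaban1987RG1, (0.1) p.251] -/
theorem val_add_le_sitesPerDir (hk : k ≤ P.m + P.K) (x : Site P 0) (ν : Fin P.d) :
    (x ν).val + P.L ^ k ≤ P.sitesPerDir 0 + (x ν).val % P.L ^ k := by
  have h1 := val_eq_of_iterBlockOf hk x ν
  have h2 : ((iterBlockOf k x) ν).val + 1 ≤ P.sitesPerDir k := ZMod.val_lt _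
  have h3 : (((iterBlockOf k x) ν).val + 1) * P.L ^ k ≤ P.sitesPerDir k * P.L ^ k := Nat.mul_le_mul_right _ h2
  have hN : P.sitesPerDir 0 = P.sitesPerDir k * P.L ^ k := by rw [sitesPerDir_zero_eq hk, mul_comm]
  rw [Nat.add_mul, one_mul] at h3
  omega

/-- The fine period exceeds `1` (at least two `k`-blocks of side `L^k ≥ 1`). [cite: Balaban1987RG1, (0.1) p.251] -/
theorem one_lt_sitesPerDir_zero (hk : k ≤ P.m + P.K) : 1 < P.sitesPerDir 0 := by
  have hNk : 2 ≤ P.sitesPerDir k := by unfold Params.sitesPerDir; have := pow_pos P.L_pos (P.m + P.K - k); omega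
  rw [sitesPerDir_zero_eq hk, mul_comm]
  exact lt_of_lt_of_le (by omega) (Nat.le_mul_of_pos_right _ (pow_pos P.L_pos k))

/-- Two fine sites lie in the same `k`-block iff their labels have the same quotients by `L^k`. [cite: Balaban1984PropagatorsI, (1.6) p.18] -/
theorem iterBlockOf_eq_iff (hk : k ≤ P.m + P.K) (x y : Site P 0) :
    iterBlockOf k x = iterBlockOf k y ↔ ∀ ν, (x ν).val / P.L ^ k = (y ν).val / P.L ^ k := by
  rw [← mem_iterBlock, mem_iterBlock_iff hk]
  refine forall_congr' fun ν => ?_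
  rw [val_iterBlockOf k hk y ν]

/-- **A STEP `+e_μ` INSIDE THE BLOCK** (offset `x_μ mod L^k + 1 < L^k`): the label goes up by one and the block is unchanged. [cite: Balaban1984PropagatorsI, (1.6) p.18] -/
theorem shift_of_offset_succ_lt (hk : k ≤ P.m + P.K) (x : Site P 0) (μ : Fin P.d) (h : (x μ).val % P.L ^ k + 1 < P.L ^ k) :
    ((x.shift μ) μ).val = (x μ).val + 1 ∧ iterBlockOf k (x.shift μ) = iterBlockOf k x := by
  have hM : 0 < P.L ^ k := pow_pos P.L_pos k
  have hN := val_add_le_sitesPerDir hk x μ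
  have hlt : (x μ).val + 1 < P.sitesPerDir 0 := by omega
  have h1v : (1 : ZMod (P.sitesPerDir 0)).val = 1 := by
    rw [ZMod.val_one_eq_one_mod, Nat.mod_eq_of_lt (one_lt_sitesPerDir_zero hk)]
  have hsv : ((x.shift μ) μ).val = (x μ).val + 1 := by
    have e1 : (x.shift μ) μ = x μ + 1 := by simp [Site.shift]
    rw [e1, ZMod.val_add, h1v, Nat.mod_eq_of_lt hlt]
  refine ⟨hsv, (iterBlockOf_eq_iff hk _ _).2 fun ν => ?_⟩
  by_cases hν : ν = μ
  · subst hν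
    rw [hsv]
    have hq := val_eq_of_iterBlockOf hk x ν
    set q := ((iterBlockOf k x) ν).val
    set r := (x ν).val % P.L ^ k
    rw [show (x ν).val / P.L ^ k = q from (val_iterBlockOf k hk x ν).symm]
    exact Nat.div_eq_of_lt_le (by rw [hq]; linarith) (by rw [hq, Nat.add_mul, one_mul]; omega)
  · have e1 : (x.shift μ) ν = x ν := by simp [Site.shift, Function.update_of_ne hν]
    rw [e1]

/-- **A STEP `−e_μ` INSIDE THE BLOCK** (offset `0 < x_μ mod L^k`): the label goes down by one and the block is unchanged. [cite: Balaban1984PropagatorsI, (1.6) p.18] -/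
theorem unshift_of_offset_pos (hk : k ≤ P.m + P.K) (x : Site P 0) (μ : Fin P.d) (h : 0 < (x μ).val % P.L ^ k) :
    ((x.unshift μ) μ).val + 1 = (x μ).val ∧ iterBlockOf k (x.unshift μ) = iterBlockOf k x := by
  have hM : 0 < P.L ^ k := pow_pos P.L_pos k
  have hr : (x μ).val % P.L ^ k < P.L ^ k := Nat.mod_lt _ hM
  have hx1 : 1 ≤ (x μ).val := le_trans h (Nat.mod_le _ _)
  have h1v : (1 : ZMod (P.sitesPerDir 0)).val = 1 := by
    rw [ZMod.val_one_eq_one_mod, Nat.mod_eq_of_lt (one_lt_sitesPerDir_zero hk)]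
  have huv : ((x.unshift μ) μ).val + 1 = (x μ).val := by
    have e1 : (x.unshift μ) μ = x μ - 1 := by simp [Site.unshift]
    rw [e1, ZMod.val_sub (by rw [h1v]; exact hx1), h1v]
    omega
  refine ⟨huv, (iterBlockOf_eq_iff hk _ _).2 fun ν => ?_⟩
  by_cases hν : ν = μ
  · subst hν
    have hq := val_eq_of_iterBlockOf hk x ν
    set q := ((iterBlockOf k x) ν).val
    set r := (x ν).val % P.L ^ k
    rw [show (x ν).val / P.L ^ k = q from (val_iterBlockOf k hk x ν).symm]
    have h3 : ((x.unshift ν) ν).val = (x ν).val - 1 := by omega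
    rw [h3]
    exact Nat.div_eq_of_lt_le (by omega) (by rw [Nat.add_mul, one_mul]; omega)
  · have e1 : (x.unshift μ) ν = x ν := by simp [Site.unshift, Function.update_of_ne hν]
    rw [e1]

/-- **LEAVING A BLOCK HAPPENS AT THE LAST OFFSET, ENTERING AT OFFSET `0`**: if `x + e_μ` lies in another `k`-block than `x`, then `x_μ mod L^k = L^k − 1` and
`(x + e_μ)_μ mod L^k = 0`. [cite: Balaban1984PropagatorsI, (1.6) p.18] -/
theorem offsets_of_iterBlockOf_shift_ne (hk : k ≤ P.m + P.K) (x : Site P 0) (μ : Fin P.d) (h : iterBlockOf k (x.shift μ) ≠ iterBlockOf k x) :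
    (x μ).val % P.L ^ k = P.L ^ k - 1 ∧ ((x.shift μ) μ).val % P.L ^ k = 0 := by
  have hM : 0 < P.L ^ k := pow_pos P.L_pos k
  have hr : (x μ).val % P.L ^ k < P.L ^ k := Nat.mod_lt _ hM
  have hlast : (x μ).val % P.L ^ k = P.L ^ k - 1 := by
    by_contra hne
    exact h (shift_of_offset_succ_lt hk x μ (by omega)).2
  refine ⟨hlast, ?_⟩
  -- `x_μ + 1` is a multiple of `L^k`, and so is the period
  have hq := val_eq_of_iterBlockOf hk x μ
  have hdvd : P.L ^ k ∣ (x μ).val + 1 := ⟨((iterBlockOf k x) μ).val + 1, by rw [hq, hlast, mul_comm (P.L ^ k), Nat.add_mul, one_mul]; omega⟩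
  have hNdvd : P.L ^ k ∣ P.sitesPerDir 0 := ⟨P.sitesPerDir k, sitesPerDir_zero_eq hk⟩
  have e1 : (x.shift μ) μ = x μ + 1 := by simp [Site.shift]
  rw [e1, ZMod.val_add, ZMod.val_one_eq_one_mod, Nat.mod_eq_of_lt (one_lt_sitesPerDir_zero hk), Nat.mod_mod_of_dvd _ hNdvd]
  exact Nat.mod_eq_zero_of_dvd hdvd

/-- conversely, **AT THE LAST OFFSET THE STEP `+e_μ` LEAVES THE BLOCK** (the torus has at least two `k`-blocks per direction). [cite: Balaban1987RG1, (0.1) p.251] -/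
theorem iterBlockOf_shift_ne_of_offset_last (hk : k ≤ P.m + P.K) (x : Site P 0) (μ : Fin P.d) (h : (x μ).val % P.L ^ k = P.L ^ k - 1) :
    iterBlockOf k (x.shift μ) ≠ iterBlockOf k x := by
  have hM : 0 < P.L ^ k := pow_pos P.L_pos k
  have hNk : 2 ≤ P.sitesPerDir k := by
    unfold Params.sitesPerDir; have := pow_pos P.L_pos (P.m + P.K - k); omega
  have hN : P.sitesPerDir 0 = P.sitesPerDir k * P.L ^ k := by rw [sitesPerDir_zero_eq hk, mul_comm]
  have hq := val_eq_of_iterBlockOf hk x μ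
  set q := ((iterBlockOf k x) μ).val with hqdef
  have hqN : q + 1 ≤ P.sitesPerDir k := ZMod.val_lt _
  have hx1 : (x μ).val + 1 = (q + 1) * P.L ^ k := by rw [hq, h, Nat.add_mul, one_mul]; omega
  intro heq
  have hν := (iterBlockOf_eq_iff hk _ _).1 heq μ
  rw [← val_iterBlockOf k hk x μ, ← hqdef] at hν
  have e1 : (x.shift μ) μ = x μ + 1 := by simp [Site.shift]
  rw [e1, ZMod.val_add, ZMod.val_one_eq_one_mod, Nat.mod_eq_of_lt (one_lt_sitesPerDir_zero hk)] at hν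
  rcases Nat.lt_or_ge ((x μ).val + 1) (P.sitesPerDir 0) with hlt | hge
  · -- no wrap: the new quotient is `q + 1`
    rw [Nat.mod_eq_of_lt hlt, hx1, Nat.mul_div_cancel _ hM] at hν
    omega
  · -- wrap: the new label is `0`, quotient `0`, but `q = N_k − 1 ≥ 1`
    have hx2 : (x μ).val + 1 = P.sitesPerDir 0 := le_antisymm (by have := ZMod.val_lt (x μ); omega) hge
    rw [hx2, Nat.mod_self, Nat.zero_div] at hν
    have : (q + 1) * P.L ^ k = P.sitesPerDir k * P.L ^ k := by rw [← hx1, hx2, hN]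
    have hq' : q + 1 = P.sitesPerDir k := Nat.eq_of_mul_eq_mul_right hM this
    omega

end Labels

/-! ## §3 The fat separable bump on the top blocks -/

section Bump

variable {P : Params} {k : ℕ}

/-- ★★★ **THE FAT SEPARABLE BLOCK BUMP.**  For every collar `0 < w` there are a bump family `χ : Site P k → Site P 0 → ℝ` and a mass `κ` — explicitly
`χ_Y(x) = Π_ν ρ(x_ν mod L^k)` on `B^k(Y)` (`0` off it), `ρ(t) = min 1 (min (t∕(wL^k)) ((L^k−1−t)∕(wL^k)))`, `κ = ((Σ_{t<L^k} ρ t)∕L^k)^d` — with: range `[0,1]`; support inside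
the block together with its neighbours (`χ_Y(x) ≠ 0 ⟹ B^k(x ± e_μ) = Y`); the bond-Lipschitz row `|χ_Y(x+e_μ) − χ_Y(x)| ≤ 1∕(w·L^k)`; the MASS IDENTITY `Σ_{x∈B^k(Y)} χ_Y(x) = κ·(L^k)^d`
for EVERY `Y`; and `(1 − 2w − 2∕L^k)^d ≤ κ ≤ 1` when `2w + 2∕L^k ≤ 1`.  These are the displayed bump rows of ✓`Prop7BlockBumpExtension.exists_blockBumpExtension` (`lχ = 1∕(wL^k) = η∕w` at the
member) and the reference-mean letter of the (P2-core) solve door. [cite: Balaban1984PropagatorsI, (1.6) p.18, (1.18) p.20; Balaban1985BackgroundPropagators, (3.114)-(3.115) p.418] -/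
theorem exists_fatBump (hk : k ≤ P.m + P.K) {w : ℝ} (hw : 0 < w) (hwin : 2 * w + 2 / (P.L : ℝ) ^ k ≤ 1) :
    ∃ (χ : Site P k → Site P 0 → ℝ) (κ : ℝ),
      (∀ Y x, 0 ≤ χ Y x ∧ χ Y x ≤ 1) ∧
      (∀ Y x μ, χ Y x ≠ 0 → iterBlockOf k (x.shift μ) = Y) ∧
      (∀ Y x μ, χ Y x ≠ 0 → iterBlockOf k (x.unshift μ) = Y) ∧
      (∀ Y x μ, |χ Y (x.shift μ) - χ Y x| ≤ 1 / (w * (P.L : ℝ) ^ k)) ∧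
      (∀ Y, ∑ x ∈ iterBlock k Y, χ Y x = κ * ((P.L : ℝ) ^ k) ^ P.d) ∧
      (1 - 2 * w - 2 / (P.L : ℝ) ^ k) ^ P.d ≤ κ ∧ κ ≤ 1 := by
  classical
  have hM : 0 < P.L ^ k := pow_pos P.L_pos k
  have hMR : (0 : ℝ) < (P.L : ℝ) ^ k := pow_pos (by exact_mod_cast P.L_pos) k
  have hcast : ((P.L ^ k : ℕ) : ℝ) = (P.L : ℝ) ^ k := by push_cast; ring
  -- the ramp, read at natural labels
  let ρ : ℕ → ℝ := fun t => min (1 : ℝ) (min ((t : ℝ) / (w * (P.L ^ k : ℕ))) ((((P.L ^ k : ℕ) : ℝ) - 1 - t) / (w * (P.L ^ k : ℕ))))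
  have hρ01 : ∀ t, t < P.L ^ k → 0 ≤ ρ t ∧ ρ t ≤ 1 := fun t ht => ramp_mem_Icc hw hM ht
  have hρ0 : ρ 0 = 0 := ramp_zero (M := P.L ^ k) hw hM
  have hρL : ρ (P.L ^ k - 1) = 0 := ramp_last hw hM
  have hρlip : ∀ t, |ρ (t + 1) - ρ t| ≤ 1 / (w * ((P.L ^ k : ℕ) : ℝ)) := fun t => abs_ramp_succ_sub_le (M := P.L ^ k) hw hM t
  -- the bump and its mass
  let χ : Site P k → Site P 0 → ℝ := fun Y x => if iterBlockOf k x = Y then ∏ ν : Fin P.d, ρ ((x ν).val % P.L ^ k) else 0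
  let S : ℝ := ∑ t ∈ Finset.range (P.L ^ k), ρ t
  obtain ⟨hSlo, hShi⟩ := sum_ramp_bounds (M := P.L ^ k) hw hM
  have hS0 : 0 ≤ S := Finset.sum_nonneg fun t ht => (hρ01 t (Finset.mem_range.mp ht)).1
  refine ⟨χ, (S / (P.L : ℝ) ^ k) ^ P.d, ?_, ?_, ?_, ?_, ?_, ?_, ?_⟩
  · -- range
    intro Y x
    by_cases hY : iterBlockOf k x = Y
    · simp only [χ, if_pos hY]
      exact ⟨Finset.prod_nonneg fun ν _ => (hρ01 _ (Nat.mod_lt _ hM)).1,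
        Finset.prod_le_one (fun ν _ => (hρ01 _ (Nat.mod_lt _ hM)).1) fun ν _ => (hρ01 _ (Nat.mod_lt _ hM)).2⟩
    · simp only [χ, if_neg hY]; exact ⟨le_rfl, zero_le_one⟩
  · -- support ⇒ the forward neighbour stays in the block
    intro Y x μ hne
    by_cases hY : iterBlockOf k x = Y
    · simp only [χ, if_pos hY] at hne
      have hμ : ρ ((x μ).val % P.L ^ k) ≠ 0 := fun h0 => hne (Finset.prod_eq_zero (Finset.mem_univ μ) h0)
      have hlt : (x μ).val % P.L ^ k + 1 < P.L ^ k := by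
        have hr : (x μ).val % P.L ^ k < P.L ^ k := Nat.mod_lt _ hM
        rcases Nat.lt_or_ge ((x μ).val % P.L ^ k + 1) (P.L ^ k) with h | h
        · exact h
        · exfalso; apply hμ; rw [show (x μ).val % P.L ^ k = P.L ^ k - 1 by omega]; exact hρL
      rw [← hY]; exact (shift_of_offset_succ_lt hk x μ hlt).2
    · exact absurd (by simp only [χ, if_neg hY]) hne
  · -- support ⇒ the backward neighbour stays in the block
    intro Y x μ hne
    by_cases hY : iterBlockOf k x = Y
    · simp only [χ, if_pos hY] at hne
      have hμ : ρ ((x μ).val % P.L ^ k) ≠ 0 := fun h0 => hne (Finset.prod_eq_zero (Finset.mem_univ μ) h0)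
      have hpos : 0 < (x μ).val % P.L ^ k := by
        rcases Nat.eq_zero_or_pos ((x μ).val % P.L ^ k) with h | h
        · exfalso; apply hμ; rw [h]; exact hρ0
        · exact h
      rw [← hY]; exact (unshift_of_offset_pos hk x μ hpos).2
    · exact absurd (by simp only [χ, if_neg hY]) hne
  · -- the bond-Lipschitz row
    intro Y x μ
    rw [← hcast]
    have hwM : 0 ≤ 1 / (w * ((P.L ^ k : ℕ) : ℝ)) := by positivity
    by_cases hY : iterBlockOf k x = Y <;> by_cases hY' : iterBlockOf k (x.shift μ) = Y
    · -- both in `Y`: the step is interior, offsets differ by `e_μ`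
      have hblk : iterBlockOf k (x.shift μ) = iterBlockOf k x := hY'.trans hY.symm
      have hlt : (x μ).val % P.L ^ k + 1 < P.L ^ k := by
        by_contra hge
        have hr : (x μ).val % P.L ^ k < P.L ^ k := Nat.mod_lt _ hM
        exact iterBlockOf_shift_ne_of_offset_last hk x μ (by omega) hblk
      have hoff : ∀ ν, ((x.shift μ) ν).val % P.L ^ k = if ν = μ then (x μ).val % P.L ^ k + 1 else (x ν).val % P.L ^ k := by
        intro ν
        by_cases hν : ν = μ
        · subst hν
          rw [if_pos rfl, (shift_of_offset_succ_lt hk x ν hlt).1, Nat.add_mod, Nat.mod_eq_of_lt (lt_of_le_of_lt (Nat.le_add_left 1 _) hlt), Nat.mod_eq_of_lt hlt]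
        · rw [if_neg hν]
          have e1 : (x.shift μ) ν = x ν := by simp [Site.shift, Function.update_of_ne hν]
          rw [e1]
      simp only [χ, if_pos hY, if_pos hY']
      rw [Finset.prod_congr rfl fun ν _ => by rw [hoff ν], ← Finset.mul_prod_erase Finset.univ _ (Finset.mem_univ μ),
        ← Finset.mul_prod_erase Finset.univ (fun ν => ρ ((x ν).val % P.L ^ k)) (Finset.mem_univ μ), if_pos rfl,
        Finset.prod_congr rfl fun ν hν => by rw [if_neg (Finset.ne_of_mem_erase hν)], ← sub_mul, abs_mul]
      have hP : |∏ ν ∈ Finset.univ.erase μ, ρ ((x ν).val % P.L ^ k)| ≤ 1 := by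
        rw [abs_of_nonneg (Finset.prod_nonneg fun ν _ => (hρ01 _ (Nat.mod_lt _ hM)).1)]
        exact Finset.prod_le_one (fun ν _ => (hρ01 _ (Nat.mod_lt _ hM)).1) fun ν _ => (hρ01 _ (Nat.mod_lt _ hM)).2
      calc |ρ ((x μ).val % P.L ^ k + 1) - ρ ((x μ).val % P.L ^ k)| * |∏ ν ∈ Finset.univ.erase μ, ρ ((x ν).val % P.L ^ k)|
          ≤ 1 / (w * ((P.L ^ k : ℕ) : ℝ)) * 1 := mul_le_mul (hρlip _) hP (abs_nonneg _) hwM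
        _ = 1 / (w * ((P.L ^ k : ℕ) : ℝ)) := mul_one _
    · -- leaving `Y`: `x` sits at the last offset, where `ρ = 0`
      have hne : iterBlockOf k (x.shift μ) ≠ iterBlockOf k x := by rw [hY]; exact hY'
      have hlast := (offsets_of_iterBlockOf_shift_ne hk x μ hne).1
      have h0 : ∏ ν : Fin P.d, ρ ((x ν).val % P.L ^ k) = 0 := Finset.prod_eq_zero (Finset.mem_univ μ) (by rw [hlast]; exact hρL)
      simp only [χ, if_pos hY, if_neg hY', h0, sub_zero, abs_zero]; exact hwM
    · -- entering `Y`: `x + e_μ` sits at offset `0`, where `ρ = 0`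
      have hne : iterBlockOf k (x.shift μ) ≠ iterBlockOf k x := by rw [hY']; exact Ne.symm hY
      have hzero := (offsets_of_iterBlockOf_shift_ne hk x μ hne).2
      have h0 : ∏ ν : Fin P.d, ρ (((x.shift μ) ν).val % P.L ^ k) = 0 := Finset.prod_eq_zero (Finset.mem_univ μ) (by rw [hzero]; exact hρ0)
      simp only [χ, if_neg hY, if_pos hY', h0, sub_zero, abs_zero]; exact hwM
    · simp only [χ, if_neg hY, if_neg hY', sub_zero, abs_zero]; exact hwM
  · -- the mass identity
    intro Y
    have h1 : ∑ x ∈ iterBlock k Y, χ Y x = ∑ x ∈ iterBlock k Y, ∏ ν : Fin P.d, ρ ((x ν).val % P.L ^ k) :=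
      Finset.sum_congr rfl fun x hx => by simp only [χ, if_pos ((mem_iterBlock k Y x).1 hx)]
    rw [h1, sum_iterBlock_eq hk Y, Finset.sum_congr rfl fun j _ => Finset.prod_congr rfl fun ν _ => by
      rw [val_blockSiteK hk, Nat.mul_add_mod', Nat.mod_eq_of_lt (j ν).isLt]]
    rw [show (∑ j : Fin P.d → Fin (P.L ^ k), ∏ ν : Fin P.d, ρ ((j ν : ℕ))) = ∏ _ν : Fin P.d, ∑ t : Fin (P.L ^ k), ρ (t : ℕ) from by
      rw [Finset.prod_univ_sum]; simp only [Fintype.piFinset_univ]]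
    rw [Finset.prod_const, Finset.card_univ, Fintype.card_fin, Fin.sum_univ_eq_sum_range (fun t => ρ t) (P.L ^ k), ← mul_pow,
      div_mul_cancel₀ _ hMR.ne']
  · -- `κ ≥ (1 − 2w − 2∕L^k)^d`
    have hlo : 1 - 2 * w - 2 / (P.L : ℝ) ^ k ≤ S / (P.L : ℝ) ^ k := by
      rw [le_div_iff₀ hMR]
      have : ((P.L ^ k : ℕ) : ℝ) * (1 - 2 * w) - 2 ≤ S := hSlo
      rw [hcast] at this
      have e : (1 - 2 * w - 2 / (P.L : ℝ) ^ k) * (P.L : ℝ) ^ k = (P.L : ℝ) ^ k * (1 - 2 * w) - 2 := by field_simp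
      linarith [e]
    exact pow_le_pow_left₀ (by linarith) hlo _
  · -- `κ ≤ 1`
    have hhi : S / (P.L : ℝ) ^ k ≤ 1 := by rw [div_le_one hMR, ← hcast]; exact hShi
    exact pow_le_one₀ (by positivity) hhi

end Bump

end Summit.QuantumFields.YangMills.Theorems.Prop7BlockFatBump

end
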